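import Summits.BirchSwinnertonDyer.BirchSwinnertonDyer.Theorems.ManinLocalTwoThreeMultiHub
import Summits.BirchSwinnertonDyer.Rank1Residual.ManinAdditive.TowerRigidity

/-!
# LEMMA MH BY NAME: `TowerExtension.MultiHubRigidLaw` holds (cell bsd-f2-manin, an g30 §72.10 / typer g15 T-an-35 `TowerRigidity.lean`)

Summit `BirchSwinnertonDyer`, route `ManinLocalTwoThree`, cruxes C3 `ManinPrimeToThreeAtNine` (stmt-BirchSwinnertonDyer-22968) / C2 `ManinOddAtFour`
(stmt-…-22967).  One-line glue: the by-value theorems `multiHubRigid` / `multiHubRigidLaw` of `…Theorems.ManinLocalTwoThreeMultiHub` (LEMMA MH for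
every admissible pair, even character sums + walk) close the typer's obligation node `TowerExtension.MultiHubRigidLaw` BY NAME, and discharge the
`hMH` binder of the typer's assembled chains `someTowerUnitTwist_of_multiHub` / `towerUnitTwistGeFive_of_multiHub`.

* `multiHubRigid_holds : … → TowerExtension.MultiHubRigid q p`;
* `multiHubRigidLaw_holds : TowerExtension.MultiHubRigidLaw` — **the law is a theorem**;
* `towerUnitTwistGeFive_of_rigidityEdges`, `someTowerUnitTwist_of_rigidityEdges` — the chain to E-an-135 (q ≥ 5) / E-an-135♭ now modulo the TWO
  remaining edges `MultiHubImpliesRigidity` (PROOFS-an-72 §5.0–5.5 bookkeeping) and `RigidityImpliesTower` (E-an-143/140 telescoping; E-an-140 is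
  the tree theorem `qFareyFibreConnected_holds`).

HONEST FRAMING: glue only.  Nothing about Manin's conjecture or BSD is proved by this.
-/

set_option linter.dupNamespace false
set_option autoImplicit false

namespace Summit.BirchSwinnertonDyer.BirchSwinnertonDyer.Theorems.ManinLocalTwoThree

open Summit.BirchSwinnertonDyer.Rank1Residual.ManinAdditive.TowerExtension

/-- LEMMA MH by name: `MultiHubRigid q p` for `q, p` prime, `q ≥ 3`, `p ∤ (q−1)/2`. -/
theorem multiHubRigid_holds {q p : ℕ} (hq : q.Prime) (hp : p.Prime) (hq3 : 3 ≤ q) (hadm : ¬ p ∣ (q - 1) / 2) :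
    MultiHubRigid q p :=
  multiHubRigid hq hp hq3 hadm

/-- **`TowerExtension.MultiHubRigidLaw` is a theorem** (an g30's LEMMA MH law, typed by typer g15 in `TowerRigidity.lean`). -/
theorem multiHubRigidLaw_holds : MultiHubRigidLaw :=
  fun _ _ hq hp hq3 _ hadm ↦ multiHubRigid hq hp hq3 hadm

/-- The typer's chain with the LEMMA MH binder discharged: the two remaining paper edges give the `q ≥ 5` tower law for every prime `p`. -/
theorem towerUnitTwistGeFive_of_rigidityEdges (hE : MultiHubImpliesRigidity) (hR : RigidityImpliesTower) {p : ℕ} (hp : p.Prime) :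
    TowerUnitTwistGeFive p :=
  towerUnitTwistGeFive_of_multiHub multiHubRigidLaw_holds hE hR hp

/-- … and the ∃q-form E-an-135♭ `SomeTowerUnitTwist p` for every prime `p`, modulo the same two edges. -/
theorem someTowerUnitTwist_of_rigidityEdges (hE : MultiHubImpliesRigidity) (hR : RigidityImpliesTower) {p : ℕ} (hp : p.Prime) :
    Summit.BirchSwinnertonDyer.Rank1Residual.ManinAdditive.KatoCurve.SomeTowerUnitTwist p :=
  someTowerUnitTwist_of_multiHub multiHubRigidLaw_holds hE hR hp

end Summit.BirchSwinnertonDyer.BirchSwinnertonDyer.Theorems.ManinLocalTwoThree
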